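import Literature.Probability.LatticeModels.DiscreteRWPartitionFunction
import Literature.Probability.LatticeModels.DiscreteRectBoundaryTrace
import HarnessLib

/-!
# The interior dual domain `Ω*_int` and the dual vertices `x*` of boundary vertices (CDH16 §2.5, §3.3)

Topic `Literature/Probability/LatticeModels` (family `crit-ising`); DEFINITIONS (no facts, nothing asserted) for
the dual side of the printed proof of CDH16 Thm. 1.1 (`fkIsing_topologicalRectangle_crossingBounds`,
`FKIsingTopologicalRectangleCrossing.lean`): Prop. 4.3 / Cor. 4.4 (`φ^∅_Ω[a ↔ c] ≳ √Z_{Ω*_int}[a*,c*]`,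
`φ^∅_Ω[N] ≳ Z_{Ω*_int}[(a*b*),(c*d*)]`), the comparison (3.8) `ℓ_{Ω*} ≍ ℓ_Ω̄` and the use of Thm. 3.9 in
`Ω*_int` (§4.3) all live on the interior dual domain. In the vocabulary of `DiscreteRectBoundaryTrace.lean`
(unit squares `DiscreteRect.quad x k` by lower-left corner, faces `DiscreteRect.faces E`, arrows and their left /
right squares `DiscreteRect.lsq`, `DiscreteRect.rsq`, the segments `DiscreteRect.slots` of the boundary trace).

D. Chelkak, H. Duminil-Copin, C. Hongler, EJP 21 (2016) no. 5 = arXiv:1312.7785: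
* §2.5 (held text p. 7): "we call `f` an interior vertex of `Ω*` if `f` is the center of a face of `Ω`. We
  denote by `Ω*_int` the (not necessarily connected) subgraph of `Ω*` formed by all interior vertices and edges
  between them. It is worth noting that `Ω*_int` is connected if `Ω` 'is made of square tiles', i.e., does not
  contain bridges."
* §3.3 (p. 10): "Given `x ∈ ∂Ω`, let `x_ext ∈ ∂_ext Ω` be the corresponding external vertex (if there are several
  external edges incident to `x`, we fix `xx_ext` to be the last of them when tracking `∂_ext Ω`
  counterclockwise). … let `xx_ext x'' x'` be a face of `ℤ²` to the left of `xx_ext` and `x*` denote the center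
  of this face. Provided that `Ω` does not contain bridges, we have `xx' ∈ 𝓔(Ω)` and `x* ∈ Ω* ∖ Ω*_int`.
  Moreover one can naturally identify `x*` with the external vertex of `Ω*_int` associated to the dual edge
  `(xx')*`."

Definitions:
* `DiscreteRect.dualInt E` — `Ω*_int` as a finite set of edges of the dual lattice (indexed by lower-left
  corners of squares, so again a `Finset (Sym2 (Site 2))` to which `DiscreteRect.graph`, `rwZ`, `rwZbar`,
  `IsRect`, `extResistance` apply verbatim): the dual edges `{f, f + e_k}` between two faces of `Ω`;
* `DiscreteRect.dualDart a = (lsq a, m + 3)` — the dual dart of an arrow `a = (p, m)`, from its left square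
  across `a`; for the arrows of `∂Ω` (walked by the trace) these are the external darts of `Ω*_int`;
* `DiscreteRect.IsLastDart E (x, k)` — "the last external edge at `x` counterclockwise" as the local condition
  `xx' ∈ E`, `x' = x + e_{k+1}` (the trace leaves `x` after this dart);
* `DiscreteRect.starDart (x, k) = (quad x (k+1), k)` — the dual vertex `x*` as the external dart of `Ω*_int`
  based at the face to the left of `xx'` and pointing to the exterior square `xx_ext x'' x' = quad x k`
  (`starDart_eq_dualDart`: it is the dual dart of the first arrow `(x, k+1)` walked from the last dart;
  `isExtDart_dualInt_starDart`: an external dart of `Ω*_int` as soon as that face is a vertex of `Ω*_int`).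

So `Z_{Ω*_int}[a*, c*] = rwZbar (dualInt E) (inr (starDart d_a)) (inr (starDart d_c))` for the last darts
`d_a, d_c` at `a, c`. API: membership, `dualInt` is a lattice domain, its vertices are faces,
`quad x (k+1) + e_k = quad x k`, the edge of `x*` towards the exterior is not in `Ω*_int`.
(Simulation note, not asserted: for simply connected domains made of square tiles without pinch points, the dual
darts of the arrows of `∂Ω` in trace order form the boundary cycle of `Ω*_int` — the intended route to an `IsRect`
presentation of the dual rectangle `(Ω*_int; a*, b*, c*, d*)`.)

## References
* [ChelkakDuminilCopinHongler2016] D. Chelkak, H. Duminil-Copin, C. Hongler, EJP 21 (2016) no. 5, §2.5, §3.3,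
  Prop. 4.3, Cor. 4.4.
-/

noncomputable section

open scoped ENNReal
open SimpleGraph Finset

namespace Literature.Probability.LatticeModels

namespace DiscreteRect

variable {E : Finset (Sym2 (Site 2))}

open scoped Classical in
/-- **The interior dual domain `Ω*_int`** of the discrete domain `Ω = ⟨E⟩` (CDH16 §2.5: "we call `f` an
interior vertex of `Ω*` if `f` is the center of a face of `Ω`. We denote by `Ω*_int` the … subgraph of `Ω*`
formed by all interior vertices and edges between them"): the dual lattice is indexed by the lower-left corners
of the unit squares (`DiscreteRect.quad`, `DiscreteRect.faces`), and `Ω*_int` is presented, like `Ω`, by its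
finite set of (dual) lattice edges `{f, f + e_k}` between two faces of `Ω` sharing a side.
[cite: ChelkakDuminilCopinHongler2016, §2.5] -/
def dualInt (E : Finset (Sym2 (Site 2))) : Finset (Sym2 (Site 2)) :=
  ((faces E ×ˢ (Finset.univ : Finset (Fin 4))).filter fun p ↦ p.1 + dir p.2 ∈ faces E).image
    fun p ↦ s(p.1, p.1 + dir p.2)

/-- **The dual dart of an arrow**: for a directed lattice edge `a = (p, m)`, the dart of the dual lattice
based at the square to the left of `a` and pointing across `a` to the square on its right
(`lsq a → rsq a`, direction `e_{m+3} = -e_{m+1}`). For an arrow walked by the boundary trace of `Ω` (left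
square a face, right square exterior) this is an external dart of `Ω*_int` — the boundary of `Ω*_int`
is traced by the dual darts of the arrows of `∂Ω`. [cite: ChelkakDuminilCopinHongler2016, §2.5 and §3.3] -/
def dualDart (a : Site 2 × Fin 4) : Site 2 × Fin 4 :=
  (lsq a, a.2 + 3)

/-- **The most counterclockwise external dart at a boundary vertex** (CDH16 §3.3: "Given `x ∈ ∂Ω`, let
`x_ext ∈ ∂_ext Ω` be the corresponding external vertex (if there are several external edges incident to `x`, we
fix `xx_ext` to be the last of them when tracking `∂_ext Ω` counterclockwise)"): an external dart `(x, k)` whose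
successor leaves `x`, i.e. the edge `x, x + e_{k+1}` is in `E` (a local condition: the next dart
`succ E (x, k)` is not the turn `(x, k + 1)`). [cite: ChelkakDuminilCopinHongler2016, §3.3] -/
def IsLastDart (E : Finset (Sym2 (Site 2))) (d : Site 2 × Fin 4) : Prop :=
  IsExtDart E d ∧ s(d.1, d.1 + dir (d.2 + 1)) ∈ E

/-- **The dual vertex `x*` of a boundary vertex** (CDH16 §3.3: "let `xx_ext x'' x'` be a face of `ℤ²` to the left
of `xx_ext` and `x*` denote the center of this face … one can naturally identify `x*` with the external vertex
of `Ω*_int` associated to the dual edge `(xx')*`"): for the last external dart `d = (x, k)` at `x`, the edge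
`xx'`, `x' = x + e_{k+1}`, is the first arrow `(x, k+1)` walked by the trace from `d`, and `x*` is the external
vertex of the dual dart of that arrow: based at the square `quad x (k+1)` (to the left of `xx'`, a face of `Ω`
when `Ω` has no bridges) and pointing in direction `e_k` to the exterior square `quad x k = xx_ext x'' x'`.
[cite: ChelkakDuminilCopinHongler2016, §3.3] -/
def starDart (d : Site 2 × Fin 4) : Site 2 × Fin 4 :=
  (quad d.1 (d.2 + 1), d.2)

/-! ### Elementary properties -/

/-- Membership in `Ω*_int`: the dual edges between two faces of `Ω` sharing a side.
[cite: ChelkakDuminilCopinHongler2016, §2.5] -/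
theorem mem_dualInt {e : Sym2 (Site 2)} :
    e ∈ dualInt E ↔ ∃ f : Site 2, ∃ k : Fin 4, f ∈ faces E ∧ f + dir k ∈ faces E ∧ e = s(f, f + dir k) := by
  classical
  simp only [dualInt, Finset.mem_image, Finset.mem_filter, Finset.mem_product, Finset.mem_univ, and_true,
    Prod.exists]
  constructor
  · rintro ⟨f, k, ⟨hf, hfk⟩, rfl⟩
    exact ⟨f, k, hf, hfk, rfl⟩
  · rintro ⟨f, k, hf, hfk, rfl⟩
    exact ⟨f, k, ⟨hf, hfk⟩, rfl⟩

/-- The dual edge between two adjacent faces belongs to `Ω*_int`. [cite: ChelkakDuminilCopinHongler2016, §2.5] -/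
theorem mem_dualInt_of_faces {f : Site 2} {k : Fin 4} (hf : f ∈ faces E) (hfk : f + dir k ∈ faces E) :
    s(f, f + dir k) ∈ dualInt E :=
  mem_dualInt.2 ⟨f, k, hf, hfk, rfl⟩

/-- `Ω*_int` is a domain of the (dual copy of the) lattice `ℤ²`: its edges are lattice edges.
[cite: ChelkakDuminilCopinHongler2016, §2.5] -/
theorem dualInt_subset_edgeSet : ∀ e ∈ dualInt E, e ∈ (zdGraph 2).edgeSet := by
  intro e he
  obtain ⟨f, k, -, -, rfl⟩ := mem_dualInt.1 he
  rw [SimpleGraph.mem_edgeSet, zdGraph_adj_iff]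
  fin_cases k
  · exact ⟨0, Or.inl (by simp [dir])⟩
  · exact ⟨1, Or.inl (by simp [dir])⟩
  · exact ⟨0, Or.inr (by simp [dir])⟩
  · exact ⟨1, Or.inr (by simp [dir])⟩

/-- The endpoints of the edges of `Ω*_int` are faces of `Ω`. [cite: ChelkakDuminilCopinHongler2016, §2.5] -/
theorem mem_faces_of_mem_dualInt {f g : Site 2} (h : s(f, g) ∈ dualInt E) : f ∈ faces E ∧ g ∈ faces E := by
  obtain ⟨f', k, hf', hfk, he⟩ := mem_dualInt.1 h
  rcases Sym2.eq_iff.1 he with ⟨rfl, rfl⟩ | ⟨rfl, rfl⟩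
  · exact ⟨hf', hfk⟩
  · exact ⟨hfk, hf'⟩

/-- The vertices of `Ω*_int` are faces of `Ω`. [cite: ChelkakDuminilCopinHongler2016, §2.5] -/
theorem verts_dualInt_subset_faces : verts (dualInt E) ⊆ faces E := by
  intro f hf
  simp only [verts, Finset.mem_biUnion] at hf
  obtain ⟨e, he, hfe⟩ := hf
  induction e using Sym2.ind with
  | h a b =>
    simp only [endpts, Sym2.lift_mk, Finset.mem_insert, Finset.mem_singleton] at hfe
    rcases hfe with rfl | rfl
    · exact (mem_faces_of_mem_dualInt he).1
    · exact (mem_faces_of_mem_dualInt he).2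

/-- The dual vertex of the last dart is the dual dart of the first arrow walked from it:
`starDart (x, k) = dualDart (x, k + 1)`. [cite: ChelkakDuminilCopinHongler2016, §3.3] -/
theorem starDart_eq_dualDart (d : Site 2 × Fin 4) : starDart d = dualDart (d.1, d.2 + 1) := by
  simp only [starDart, dualDart, lsq_mk, Prod.mk.injEq, true_and]
  abel

/-- The target square of `x*`: `quad x (k+1) + e_k = quad x k`, the exterior square `xx_ext x'' x'` on the
missing edge `xx_ext`. [folklore] -/
theorem quad_add_one_add_dir (x : Site 2) (k : Fin 4) : quad x (k + 1) + dir k = quad x k := by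
  rw [Site.eq_iff_two]
  fin_cases k <;> simp [quad, dir]

/-- The exterior square of an external dart is not a face, so the dual edge of `x*` pointing to it is not an
edge of `Ω*_int`. [cite: ChelkakDuminilCopinHongler2016, §3.3] -/
theorem starDart_edge_notMem_dualInt {d : Site 2 × Fin 4} (hd : IsExtDart E d) :
    s((starDart d).1, (starDart d).1 + dir (starDart d).2) ∉ dualInt E := by
  intro hmem
  have h2 := (mem_faces_of_mem_dualInt hmem).2
  simp only [starDart] at h2
  rw [quad_add_one_add_dir, mem_faces] at h2
  exact not_inF_quad hd.2 h2

/-- **`x*` is an external vertex of `Ω̄*_int`**: for an external dart `d = (x, k)` of `Ω` whose left-hand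
square `quad x (k+1)` is a (non-isolated) vertex of `Ω*_int`, the dual dart `starDart d` is an external dart of
`Ω*_int`. [cite: ChelkakDuminilCopinHongler2016, §3.3] -/
theorem isExtDart_dualInt_starDart {d : Site 2 × Fin 4} (hd : IsExtDart E d)
    (hv : quad d.1 (d.2 + 1) ∈ verts (dualInt E)) : IsExtDart (dualInt E) (starDart d) :=
  ⟨hv, starDart_edge_notMem_dualInt hd⟩

/-- A last dart is an external dart. [cite: ChelkakDuminilCopinHongler2016, §3.3] -/
theorem IsLastDart.isExtDart {d : Site 2 × Fin 4} (h : IsLastDart E d) : IsExtDart E d := h.1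

/-- The successor of a last dart leaves the vertex along the edge `xx'`: the first arrow walked from `d` is
`(x, k+1)`. [cite: ChelkakDuminilCopinHongler2016, §3.3] -/
theorem IsLastDart.mem_slots {d : Site 2 × Fin 4} (h : IsLastDart E d) : (d.1, d.2 + 1) ∈ slots E d :=
  mem_slots_iff.2 (Or.inl ⟨h.2, rfl⟩)

end DiscreteRect

end Literature.Probability.LatticeModels

end
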